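import Summits.BirchSwinnertonDyer.BirchSwinnertonDyer.Theorems.PrintCFramJZeroThreeUnitRegimePrimePair
import Summits.BirchSwinnertonDyer.BirchSwinnertonDyer.Theorems.PrintCFramBottomClassIndexLawFiveLeKrizLiLocusLValueFree
import Summits.BirchSwinnertonDyer.BirchSwinnertonDyer.Theorems.BiquadraticEisensteinDescentHeegnerTwistCouplingInSupplySylvesterCornerTable
import Literature.NumberTheory.EllipticCurves.KrizLi2019.TeichmullerCharacterExists
import Literature.NumberTheory.EllipticCurves.DeuringHeckeContinuationHolds
import HarnessLib

set_option linter.dupNamespace false -- `Summit.BirchSwinnertonDyer.BirchSwinnertonDyer.Theorems.…` (summit = sub, D-0017)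
set_option autoImplicit false

/-!
# Crux `HeegnerTwistCouplingInSupply` (stmt-BirchSwinnertonDyer-21381) — the `j = 0` quadratic-twist corner QT27₊ through the
# KRIZ–LI DOOR: `W ≅ y² = x³ + q·m²` (`27a^{(q)}`: `m = 4q`), `q ≡ 5 (mod 12)` prime, at the crux prime `p = q`, MODULO PRINT ONLY

Route `BiquadraticEisensteinDescent` (cell `pub/bsd-wall`, width seat `bsd-wall-cm-bed-w4` g27; `--supports` 21381, helper;
answers `Cruxes/HeegnerTwistCouplingInSupply/KL3-CORNERS-bsd-idea-18-g21.md` §3 «kernel option `cruxOnQT27Plus_of_facts`» and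
is the door the `j = 0` cards `eisenstein-prime-switch` / `root-lattice-burgess-thin-dh` plug into). The companion
`…SylvesterCorner*.lean` (w4 g26) certifies the crux's `L`-conjunct on the `j = 0` corner through an UNFORMALISED `3`-descent
hypothesis `hDesc`. Here the `L`-conjunct comes from PRINT: Kriz–Li, Forum Math. Sigma 7 (2019) e15, Thm. 1.20 at THEIR prime
`p_KL = 3` — where every `j = 0` curve is Eisenstein, `W[3]^{ss} ≅ 𝔽₃(ψ) ⊕ 𝔽₃(ψ⁻¹ω)` with `ψ = (·/q)` for
`W ≅ y² = x³ + q·m²` — read through the cell `bsd-print-cfram`'s discharges BY NAME (`PrintCFram.hss_three_of_mordell_int`: the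
trace form; `legendreChar_three_*`: `ψ` primitive, (1) `ψ(3) = (3/q) = −1`; `bernoulli_hypothesis_prime_pair`: the Bernoulli unit
condition ⟺ the two INTEGER CERTIFICATES `3 ∤ S₁(q, r) = Σ_{j<qr} (j/q)(j/r)·j` and `3 ∥ S₂(q) = Σ_{j<3q} (j/q)(j/3)·j`, i.e.
`3 ∤ h(−qr)` and `3 ∤ h(−3q)`; `isKroneckerCharacterOf_legendre`: `ε_K = (·/r)↑` for `K = ℚ(√−r)`) and `PrintCFram.KrizLiLValueFree`
(`lDerivEK_ne_zero_of_thm120`: Thm. 1.20 ⟹ Heegner point non-torsion ⟹ `L′(W/K, 1) ≠ 0` by Gross–Zagier BY NAME).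

* §1 the door on the `j = 0` leaf WITHOUT the modularity leaf: `L′(W/K,1) = L′(W,1)·L(W^{(d_K)},1)` with PER-CURVE continuations
  (`lDerivEK_eq_deriv_mul`), both DISCHARGED for `j(W) = j(W^{(d_K)}) = 0` by the tree's Deuring–Hecke leaf
  (`DeuringHecke.hasEntireLFunction_of_j_mem`, proved); the Heegner datum is produced from the named fact `exists_isHeegnerPoint`
  (`twist_L_one_ne_zero_of_thm120_three`);
* §2 ★ `heegner_and_twist_L_one_ne_zero_of_prime_pair`: for primes `q ≡ 1 (mod 4)` with `J(3 | q) = −1` (⟺ `q ≡ 5 (mod 12)`: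
  CM-inert) and `r ≡ 3 (mod 4)`, `r ≠ 3`, with `J(−r | 3) = J(−r | q) = 1` and the two certificates: for EVERY globally minimal `W`
  with `C • W = y² = x³ + q·m²` (`qm²` sixth-power-free), `a₂(W) = 0` if `W` is good at `2`, bad primes `⊂ {3, q} ∪ {listed ℓ}`,
  `r_an(W) ≠ 0`, and `K` with `d_K = −r`: `K` is Heegner for `N(W)` and **`L(W^{(−r)}, 1) ≠ 0`, `r_an(W^{(−r)}) = 0`** — modulo
  `hKL` (Kriz–Li 1.20), `hGZ` (Gross–Zagier), `hHP` (Heegner-point existence) ONLY;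
* §3 ★ `cruxConclusion_of_prime_pair` / `exists_cruxConclusion_of_prime_pair`: with `h(−r) < q` (so `q ∤ h(−r)` by SIZE) the
  CONCLUSION of crux 21381 at `(W, q)` — `∃ K′` imaginary quadratic, `4 < |d_{K′}|`, Heegner for `N(W)`, `L(W^{(d_{K′})}, 1) ≠ 0`,
  `q ∤ h(K′)` — the field `K′ = ℚ(√−r)` produced by the tree (`SylvesterCorner.exists_field_of_odd`).
  The companion `…KrizLiCornerQT27Instances.lean` decides the certificates for `q ∈ {5, 17, 41, 53, 89, …}`.

WHY THIS IS THE CRUX'S CORNER: `27a^{(q)} = (y² + y = x³)^{(q)} ≅ y² = x³ + q³/4 ≅ y² = x³ + 16q³ = x³ + q·(4q)²` (`m = 4q`,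
`16q³` sixth-power-free), CM by `ℤ[ζ₃]`, `q ≡ 2 (mod 3)` inert, additive at `q`, root number `−1` (KL3-CORNERS §0 (c)); for
`q ≡ 1 (mod 4)` its conductor is `27q²` (good at `2`, where `a₂ = 0`: supersingular). The displayed per-curve binders `hW`, `h6`,
`h2`, `hS` are the cell `bsd-print-cfram`'s (class theorems `PrintCFram.bsdp_three_of_unitRegime_prime_pair`), unchanged.

HONEST FRAMING: a typed sub-corner on ONE more CM family (measure zero in «all CM `W`»), at the primes `q ≡ 5 (mod 12)` with
`3 ∤ h(−3q)` (KL3-regular; `q = 29, 113, 137, 173, 257, 281, 353` are not); conditional on three REFEREED named facts (Kriz–Li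
2019 Thm. 1.20, Gross–Zagier, Heegner points over `K`) — NO descent hypothesis, NO Burungale–Tian; per `q` ONE decidable
certificate `r`. X12₊ (`q ≡ 11 (mod 12)`, conductor-`4q` character) is not treated. The crux (residual C⁺ / (S3′)(p) for all
`p`), its registered stubs and BSD are NOT proved by any of this. THEOREMS ONLY (no `def`, no new named fact, no sorry).
Supports stmt-BirchSwinnertonDyer-21381.
[cite: KrizLi2019, Thm. 1.20 (pp. 7–8), §1.5 (1), §10.3] [cite: GrossZagier1986, Thm. I.(6.3), V.§1–2] [cite: Gross1991, (1.1)]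
[cite: Gross1984, §§3–4] [cite: SilvermanATAEC1994, Ch. II Cor. 10.5.1] [cite: Washington1997, Thm. 4.2] [cite: Cox2013, §1.C Lemma 1.14]
-/

noncomputable section

open scoped Classical

namespace Summit.BirchSwinnertonDyer.BirchSwinnertonDyer.Theorems.KrizLiCornerQT27

open _root_.WeierstrassCurve NumberField Field DirichletCharacter
open Literature.NumberTheory.EllipticCurves Literature.NumberTheory.EllipticCurves.KrizLi2019
  Literature.NumberTheory.EllipticCurves.ModularForms Literature.NumberTheory.QuadraticFields
  Literature.NumberTheory.QuadraticFields.Quadratic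
  Summit.BirchSwinnertonDyer.Rank1Residual.X12.O11.RouteU
  Summit.BirchSwinnertonDyer.Rank1Residual.X12
  Summit.BirchSwinnertonDyer.BirchSwinnertonDyer.Theorems.PrintCFram

/-! ## §1 The Kriz–Li door on the `j = 0` leaf, without the modularity leaf -/

section Door

variable (W : WeierstrassCurve ℚ) (K : Type) [Field K] [NumberField K]

/-- **`L′(W/K, 1) = L′(W, 1)·L(W^{(d_K)}, 1)` when `L(W, 1) = 0`** — product rule on the DEFINITION
`L(W/K, s) = L(W, s)·L(W^{(d_K)}, s)` of the tree's `LDerivEK`, with PER-CURVE continuation hypotheses (the tree's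
`lDerivEK_eq_deriv_mul_of_entireLFunction_one_eq_zero` is the same under the global modularity leaf).
[cite: GrossZagier1986, V.§1 (p. 308: "L′(f,1) L_ε(f,1) = L′(f,1,1)")] -/
theorem lDerivEK_eq_deriv_mul (hW : W.HasEntireLFunction)
    (hWt : (W.quadraticTwist (NumberField.discr K : ℚ)).HasEntireLFunction) (h0 : W.entireLFunction 1 = 0) :
    LDerivEK W K = deriv W.entireLFunction 1 * (W.quadraticTwist (NumberField.discr K : ℚ)).entireLFunction 1 := by
  have hdW : DifferentiableAt ℂ W.entireLFunction 1 := (W.differentiable_entireLFunction hW) 1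
  have hdW' : DifferentiableAt ℂ (W.quadraticTwist (NumberField.discr K : ℚ)).entireLFunction 1 :=
    ((W.quadraticTwist (NumberField.discr K : ℚ)).differentiable_entireLFunction hWt) 1
  unfold LDerivEK
  rw [deriv_fun_mul hdW hdW', h0, zero_mul, add_zero]

/-- **`L′(W/K, 1) ≠ 0` and `L(W, 1) = 0` give `L(W^{(d_K)}, 1) ≠ 0`** (per-curve continuations). [cite: GrossZagier1986, V.§1 (p. 308)] -/
theorem twist_entireLFunction_one_ne_zero_of_lDerivEK_ne_zero (hW : W.HasEntireLFunction)
    (hWt : (W.quadraticTwist (NumberField.discr K : ℚ)).HasEntireLFunction) (h0 : W.entireLFunction 1 = 0)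
    (hL : LDerivEK W K ≠ 0) : (W.quadraticTwist (NumberField.discr K : ℚ)).entireLFunction 1 ≠ 0 := by
  rw [lDerivEK_eq_deriv_mul W K hW hWt h0] at hL
  exact right_ne_zero_of_mul hL

/-- ★ **The Kriz–Li door at `p_KL = 3` on the `j = 0` leaf.** For a globally minimal `W/ℚ` with `j(W) = 0` and `r_an(W) ≠ 0`,
an imaginary quadratic `K` Heegner for `N(W)`, and Kriz–Li's data at `3` — `(f, ψ, ω)` (`ψ` primitive, `ω` Teichmüller), the
trace form `hss`, (1) `h1a`/`h1b`, (3) `h3`, a Kronecker character `ε_K`, the Bernoulli unit condition `hB` — MODULO the named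
facts `hKL` (Kriz–Li Thm. 1.20), `hGZ` (Gross–Zagier), `hHP` (a Heegner point `P_K ∈ W(K)` exists): **`L(W^{(d_K)}, 1) ≠ 0` and
`r_an(W^{(d_K)}) = 0`.** Chain: `hHP` gives the Heegner datum; `PrintCFram.KrizLiLValueFree.lDerivEK_ne_zero_of_thm120` (Thm. 1.20
⟹ `log_ω P ≠ 0` ⟹ `P` non-torsion ⟹ GZ) gives `L′(W/K, 1) ≠ 0` (Kriz–Li's (2) is vacuous for CM, `3 ∣ N(W)` as `j = 0`); both
continuations come from the Deuring–Hecke leaf (proved: `DeuringHecke.hasEntireLFunction_of_j_mem`, `j(W^{(d_K)}) = j(W) = 0`);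
`L(W,1) = 0` from `r_an(W) ≠ 0` (`analyticRank_eq_zero_iff_holds`); §1 product rule. No modularity leaf, no descent.
[cite: KrizLi2019, Thm. 1.20 (pp. 7–8)] [cite: GrossZagier1986, Thm. I.(6.3), V.§1–2] [cite: SilvermanATAEC1994, Ch. II Cor. 10.5.1] -/
theorem twist_L_one_ne_zero_of_thm120_three (hKL : thm120_padicLogHeegner_unit_of_bernoulli)
    [W.IsElliptic] [W.IsGloballyMinimal] [NeZero (W.conductorNorm ℤ)] (hj : W.j = 0) (hr : W.analyticRank ≠ 0)
    (hK : IsImaginaryQuadratic K) (hHN : SatisfiesHeegnerHypothesis (W.conductorNorm ℤ) K)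
    (hGZ : gross_zagier (W.conductorNorm ℤ) W K) (hHP : exists_isHeegnerPoint W K)
    (f : ℕ) [NeZero f] (ψ : DirichletCharacter ℚ_[3] f) (ω : DirichletCharacter ℚ_[3] 3)
    (hψ : ψ.IsPrimitive) (hω : IsTeichmullerCharacter ω)
    (hss : ∀ ℓ : ℕ, ℓ.Prime → ¬ (ℓ ∣ 3 * W.conductorNorm ℤ) →
      ‖((W.LFunction ℓ : ℤ) : ℚ_[3]) - (ψ (ℓ : ZMod f) + ψ⁻¹ (ℓ : ZMod f) * ω (ℓ : ZMod 3))‖ < 1)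
    (h1a : ψ (3 : ZMod f) ≠ 1) (h1b : primVal (invMulOmega ψ ω) 3 ≠ 1)
    (h3 : ∀ ℓ : ℕ, (hℓ : ℓ.Prime) → ℓ ≠ 3 →
      (haveI := Fact.mk hℓ; ¬ W.HasGoodReductionAtPrime ℓ ∧ ¬ W.HasMultiplicativeReductionAtPrime ℓ) →
      ψ (ℓ : ZMod f) ≠ 1 ∧ primVal (invMulOmega ψ ω) ℓ ≠ 1)
    (εK : DirichletCharacter ℚ_[3] (NumberField.discr K).natAbs) (hεK : IsKroneckerCharacterOf K εK)
    (hB : ¬ (‖bernoulliOnePrim (bernoulliCharOne ψ εK) * bernoulliOnePrim (bernoulliCharTwo ψ εK ω)‖ ≤ ((3 : ℕ) : ℝ)⁻¹)) :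
    (W.quadraticTwist (NumberField.discr K : ℚ)).entireLFunction 1 ≠ 0 ∧
      (W.quadraticTwist (NumberField.discr K : ℚ)).analyticRank = 0 := by
  haveI : Fact (Nat.Prime 3) := ⟨Nat.prime_three⟩
  have hd0 : (NumberField.discr K : ℚ) ≠ 0 := by exact_mod_cast NumberField.discr_ne_zero K
  haveI := W.isElliptic_quadraticTwist hd0
  -- the Heegner datum from the named fact
  obtain ⟨P, Dt, H, ι, hP⟩ := hHP hK hHN
  -- Kriz–Li (2) is vacuous for CM; `3 ∣ N(W)` since `j = 0`
  have h2 := not_hasSplitMultiplicativeReductionAtPrime_of_hasCM W (W.hasCM_of_j_eq_zero hj)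
  have h3N : 3 ∣ W.conductorNorm ℤ :=
    (W.dvd_conductorNorm_iff_not_hasGoodReductionAtPrime 3).mpr (JZeroThree.not_good_three_of_j_eq_zero W hj)
  -- `L′(W/K, 1) ≠ 0`
  have hL' : LDerivEK W K ≠ 0 :=
    KrizLiLValueFree.lDerivEK_ne_zero_of_thm120 hKL (by norm_num) W h2 (W.conductorNorm ℤ) K hGZ Dt H ι P rfl hK hHN h3N
      hP f ψ ω hψ hω hss h1a h1b h3 εK hεK hB
  -- continuations from the Deuring–Hecke leaf (`j = 0` for `W` and its twist)
  have hjm : W.j ∈ maximalCMJInvariants := by rw [hj]; simp [maximalCMJInvariants]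
  have hjt : (W.quadraticTwist (NumberField.discr K : ℚ)).j ∈ maximalCMJInvariants := by
    rw [W.j_quadraticTwist hd0]; exact hjm
  have hW : W.HasEntireLFunction := DeuringHecke.hasEntireLFunction_of_j_mem W hjm
  have hWt : (W.quadraticTwist (NumberField.discr K : ℚ)).HasEntireLFunction :=
    DeuringHecke.hasEntireLFunction_of_j_mem _ hjt
  have h0 : W.entireLFunction 1 = 0 := by
    by_contra h
    exact hr ((analyticRank_eq_zero_iff_holds (W := W) hW).2 h)
  have hL := twist_entireLFunction_one_ne_zero_of_lDerivEK_ne_zero W K hW hWt h0 hL'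
  exact ⟨hL, (analyticRank_eq_zero_iff_holds (W := W.quadraticTwist (NumberField.discr K : ℚ)) hWt).2 hL⟩

end Door

/-! ## §2 ★ The prime-pair corner `(q, −r)`: `W ≅ y² = x³ + q·m²`, `ψ = (·/q)`, `K = ℚ(√−r)` -/

section PrimePair

/-- ★ **QT27₊ through the Kriz–Li door, for a PRIME PAIR `(q, −r)`.** For primes `q ≡ 1 (mod 4)` with `J(3 | q) = −1` (so
`q ≡ 5 (mod 12)`; Kriz–Li (1): `ψ(3) = (3/q) ≠ 1`) and `r ≡ 3 (mod 4)`, `r ≠ 3`, with `3` and `q` split in `K = ℚ(√−r)`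
(`J(−r | 3) = J(−r | q) = 1`) and the two integer certificates `3 ∤ S₁(q,r) = Σ_{j<qr} (j/q)(j/r)·j` (`⟺ 3 ∤ h(−qr)`),
`3 ∥ S₂(q) = Σ_{j<3q} (j/q)(j/3)·j` (`⟺ 3 ∤ h(−3q)`, KL3-regularity): for every globally minimal `W/ℚ` with
`C • W = y² = x³ + q·m²` (`m ∈ ℤ`, `qm²` sixth-power-free), `a₂(W) = 0` if `W` is good at `2`, every bad prime equal to `3`, `q`
or a prime `ℓ ≡ 1 (mod 3)` with `J(ℓ | q) = −1`, `J(−r | ℓ) = 1`, and `r_an(W) ≠ 0`, and every `K` with `d_K = −r`: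
**`K` is Heegner for `N(W)`, `L(W^{(d_K)}, 1) ≠ 0` and `r_an(W^{(d_K)}) = 0`** — MODULO `hKL`, `hGZ`, `hHP` only. The character
and certificate plumbing is the cell `bsd-print-cfram`'s (`PrintCFram.bsdp_three_of_unitRegime_prime_pair`), BY NAME.
[cite: KrizLi2019, Thm. 1.20 (pp. 7–8), §1.5 (1), §10.3] [cite: GrossZagier1986, Thm. I.(6.3), V.§1–2]
[cite: Washington1997, Thm. 4.2] [cite: Cox2013, §1.C Lemma 1.14] -/
theorem heegner_and_twist_L_one_ne_zero_of_prime_pair (hKL : thm120_padicLogHeegner_unit_of_bernoulli)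
    -- the prime pair and its decidable numerics
    {q r : ℕ} [hq : Fact q.Prime] [hrp : Fact r.Prime] (hq4 : q % 4 = 1) (hr4 : r % 4 = 3)
    (hr3 : r ≠ 3) (h1 : jacobiSym 3 q = -1)
    (hs3 : jacobiSym (-(r : ℤ)) 3 = 1) (hsq : jacobiSym (-(r : ℤ)) q = 1)
    (hS₁ : ¬ ((3 : ℤ) ∣ ∑ j ∈ Finset.range (q * r),
      legendreSym q (j : ℤ) * legendreSym r (j : ℤ) * (j : ℤ)))
    (hS₂ : (3 : ℤ) ∣ ∑ j ∈ Finset.range (q * 3),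
      legendreSym q (j : ℤ) * legendreSym 3 (j : ℤ) * (j : ℤ) ^ (0 + 1))
    (hS₂' : ¬ ((3 : ℤ) ^ 2 ∣ ∑ j ∈ Finset.range (q * 3),
      legendreSym q (j : ℤ) * legendreSym 3 (j : ℤ) * (j : ℤ) ^ (0 + 1)))
    -- the curve: a globally minimal `j = 0` curve `≅ y² = x³ + q·m²`
    (W : WeierstrassCurve ℚ) [W.IsElliptic] [W.IsGloballyMinimal] [NeZero (W.conductorNorm ℤ)]
    {m : ℤ} (hm : m ≠ 0) (hW : ∃ C : VariableChange ℚ, C • W = mordellCurve ((q : ℚ) * (m : ℚ) ^ 2))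
    (h6 : ∀ ℓ : ℕ, ℓ.Prime → ¬ ((ℓ : ℤ) ^ 6 ∣ (q : ℤ) * m ^ 2))
    (h2 : (haveI : Fact (Nat.Prime 2) := ⟨Nat.prime_two⟩; W.HasGoodReductionAtPrime 2) →
      W.LFunction 2 = 0)
    (hS : ∀ ℓ : ℕ, (hℓ : ℓ.Prime) → ¬ (haveI := Fact.mk hℓ; W.HasGoodReductionAtPrime ℓ) →
      ℓ = 3 ∨ ℓ = q ∨ (ℓ % 3 = 1 ∧ jacobiSym (ℓ : ℤ) q = -1 ∧ jacobiSym (-(r : ℤ)) ℓ = 1))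
    (hr1 : W.analyticRank ≠ 0)
    -- the Heegner field `ℚ(√−r)` and the three PRINT facts
    (K : Type) [Field K] [NumberField K] (hK : IsImaginaryQuadratic K) (hdK : NumberField.discr K = -(r : ℤ))
    (hGZ : gross_zagier (W.conductorNorm ℤ) W K) (hHP : exists_isHeegnerPoint W K) :
    SatisfiesHeegnerHypothesis (W.conductorNorm ℤ) K ∧
      (W.quadraticTwist (NumberField.discr K : ℚ)).entireLFunction 1 ≠ 0 ∧
      (W.quadraticTwist (NumberField.discr K : ℚ)).analyticRank = 0 := by
  haveI : NeZero q := ⟨hq.out.ne_zero⟩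
  haveI : NeZero (NumberField.discr K).natAbs := ⟨Int.natAbs_ne_zero.mpr (NumberField.discr_ne_zero K)⟩
  haveI : Fact (Nat.Prime 3) := ⟨Nat.prime_three⟩
  have hq2 : q ≠ 2 := by omega
  have hr2 : r ≠ 2 := by omega
  have hq3 : q ≠ 3 := by
    rintro rfl
    rw [jacobiSym.eq_zero_iff.mpr ⟨by norm_num, by decide⟩] at h1
    norm_num at h1
  have hqr : q ≠ r := by omega
  -- the characters `ψ = (·/q)`, `ε = (·/r)`, `ε_K = ε↑`, and a Teichmüller `ω` mod `3`
  obtain ⟨χq, hχq⟩ := exists_legendreCharacter_three q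
  obtain ⟨χr, hχr⟩ := exists_legendreCharacter_three r
  obtain ⟨ω, hω⟩ := exists_isTeichmullerCharacter (p := 3)
  have hrd : r ∣ (NumberField.discr K).natAbs := by rw [hdK, Int.natAbs_neg, Int.natAbs_natCast]
  have hne : χq ≠ 1 := legendreChar_three_ne_one χq hχq hq2
  have hωne : ω ≠ 1 := ne_one_of_isTeichmullerCharacter (p := 3) (by norm_num) hω
  -- `j(W) = 0`
  have hj : W.j = 0 := by
    obtain ⟨C, hC⟩ := hW
    have hc4 : (C • W).c₄ = 0 := by rw [hC, mordellCurve_c₄]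
    have h1' : (C • W).j = W.j := variableChange_j W C
    have h2' : (C • W).j = 0 := by rw [WeierstrassCurve.j, hc4]; simp
    rw [← h1', h2']
  -- the Mordell datum in the `(d, m)` currency of the trace-form files
  have hW' : ∃ C : VariableChange ℚ, C • W = mordellCurve (((q : ℤ) : ℚ) * (m : ℚ) ^ 2) := by
    simpa using hW
  have hsf : Squarefree (q : ℤ) := by
    rw [Int.squarefree_natCast]; exact hq.out.squarefree
  -- `hss` (`ψ(ℓ) = J(q | ℓ)` at every odd prime `ℓ` by reciprocity, `q ≡ 1 (mod 4)`)
  have hss := hss_three_of_mordell_int W hsf hm hW' h6 h2 χq ω hω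
    (legendreChar_three_mul_self χq hχq) (fun ℓ hℓ _ hℓ1 => by
      have := legendreChar_three_apply_prime_eq_jacobiSym χq hχq hq4 hℓ (by omega)
      simpa using this)
  -- the Heegner hypothesis: every bad prime is `3`, `q` or a listed `ℓ`, all split in `ℚ(√−r)`
  have hHN : SatisfiesHeegnerHypothesis (W.conductorNorm ℤ) K := by
    intro p hp hpN
    haveI := Fact.mk hp
    have hbad : ¬ W.HasGoodReductionAtPrime p := fun hgood =>
      not_dvd_conductorNorm_of_hasGoodReductionAtPrime W hgood hpN
    rcases hS p hp hbad with h3 | hq' | ⟨hp1, -, hJ⟩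
    · rw [h3] at hp ⊢
      exact ncard_primesOver_eq_two_of_jacobiSym_neg hK.1 hdK hp (by norm_num) hs3
    · rw [hq'] at hp ⊢
      exact ncard_primesOver_eq_two_of_jacobiSym_neg hK.1 hdK hp hq2 hsq
    · exact ncard_primesOver_eq_two_of_jacobiSym_neg hK.1 hdK hp (by omega) hJ
  -- (1a): `ψ(3) = (3/q) = J(3 | q) = −1`
  have h1a : χq (3 : ZMod q) ≠ 1 := by
    refine legendreChar_three_apply_three_ne_one χq hχq ?_
    rw [jacobiSym.legendreSym.to_jacobiSym]; exact h1
  refine ⟨hHN, twist_L_one_ne_zero_of_thm120_three W K hKL hj hr1 hK hHN hGZ hHP q χq ω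
    (legendreChar_three_isPrimitive χq hχq hq2) hω hss h1a
    (primVal_invMulOmega_ne_one_of_prime_level hq3 χq hne ω hωne (Or.inr (dvd_refl 3)))
    (fun ℓ hℓ hℓ3 hbad => ?_) (changeLevel hrd χr) (isKroneckerCharacterOf_legendre hr4 hK.1 hdK χr hχr hrd)
    (bernoulli_hypothesis_prime_pair hq4 hr2 hqr hq3 hr3 hrd χq hχq χr hχr ω hω hS₁ hS₂ hS₂')⟩
  -- (3) at the additive primes `ℓ ≠ 3`
  rcases hS ℓ hℓ hbad.1 with h3 | hq' | ⟨hℓ1, hJq, -⟩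
  · exact absurd h3 hℓ3
  · -- `ℓ = q`: both characters vanish
    rw [hq']
    exact ⟨legendreChar_three_apply_ne_one_of_dvd χq hχq (dvd_refl q),
      primVal_invMulOmega_ne_one_of_prime_level hq3 χq hne ω hωne (Or.inl (dvd_refl q))⟩
  · -- a listed `ℓ ≡ 1 (mod 3)` with `(ℓ/q) = −1`: `ψ(ℓ) = −1`, `(ψ⁻¹ω)(ℓ) = −(ℓ/3) = −1`
    have hℓq : ℓ ≠ q := by
      intro he
      rw [he, jacobiSym.mod_left, Int.emod_self, jacobiSym.zero_left hq.out.one_lt] at hJq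
      norm_num at hJq
    have hval : χq (ℓ : ZMod q) = -1 := by
      rw [hχq, jacobiSym.legendreSym.to_jacobiSym, hJq]; norm_num
    have hω1 : ω (ℓ : ZMod 3) = 1 := by
      have := teichmuller_three_apply_of_emod_eq_one hω (ℓ : ℤ) (by exact_mod_cast hℓ1)
      simpa [Int.cast_natCast] using this
    have hcop : ℓ.Coprime (q * 3) := Nat.Coprime.mul_right
      ((Nat.coprime_primes hℓ hq.out).mpr hℓq) ((Nat.coprime_primes hℓ Nat.prime_three).mpr hℓ3)
    have hinv : χq⁻¹ = χq := inv_eq_of_mul_eq_one_right (legendreChar_three_mul_self χq hχq)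
    refine ⟨by rw [hval]; norm_num, ?_⟩
    rw [primVal_invMulOmega_of_coprime χq ω hcop, hinv, hval, hω1]
    norm_num

end PrimePair

/-! ## §3 ★ The crux conclusion at `(W, q)`: the `q`-half is free by SIZE (`h(−r) < q`) -/

section Crux

/-- ★ **The CONCLUSION of crux 21381 at `(W, q)` from a prime-pair certificate, `K′ = K` displayed.** In the situation of
`heegner_and_twist_L_one_ne_zero_of_prime_pair`, if moreover `h(K) < q`, then: `K` is imaginary quadratic, `4 < |d_K|` (`r ≥ 7`),
Heegner for `N(W)`, `L(W^{(d_K)}, 1) ≠ 0`, `h(K) < q` and `q ∤ h(K)` — modulo `hKL`, `hGZ`, `hHP` only.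
[cite: KrizLi2019, Thm. 1.20 (pp. 7–8)] [cite: GrossZagier1986, Thm. I.(6.3), V.§1–2] [cite: Cox2013, §1.C Lemma 1.14] -/
theorem cruxConclusion_of_prime_pair (hKL : thm120_padicLogHeegner_unit_of_bernoulli)
    {q r : ℕ} [hq : Fact q.Prime] [hrp : Fact r.Prime] (hq4 : q % 4 = 1) (hr4 : r % 4 = 3)
    (hr3 : r ≠ 3) (h1 : jacobiSym 3 q = -1)
    (hs3 : jacobiSym (-(r : ℤ)) 3 = 1) (hsq : jacobiSym (-(r : ℤ)) q = 1)
    (hS₁ : ¬ ((3 : ℤ) ∣ ∑ j ∈ Finset.range (q * r),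
      legendreSym q (j : ℤ) * legendreSym r (j : ℤ) * (j : ℤ)))
    (hS₂ : (3 : ℤ) ∣ ∑ j ∈ Finset.range (q * 3),
      legendreSym q (j : ℤ) * legendreSym 3 (j : ℤ) * (j : ℤ) ^ (0 + 1))
    (hS₂' : ¬ ((3 : ℤ) ^ 2 ∣ ∑ j ∈ Finset.range (q * 3),
      legendreSym q (j : ℤ) * legendreSym 3 (j : ℤ) * (j : ℤ) ^ (0 + 1)))
    (W : WeierstrassCurve ℚ) [W.IsElliptic] [W.IsGloballyMinimal] [NeZero (W.conductorNorm ℤ)]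
    {m : ℤ} (hm : m ≠ 0) (hW : ∃ C : VariableChange ℚ, C • W = mordellCurve ((q : ℚ) * (m : ℚ) ^ 2))
    (h6 : ∀ ℓ : ℕ, ℓ.Prime → ¬ ((ℓ : ℤ) ^ 6 ∣ (q : ℤ) * m ^ 2))
    (h2 : (haveI : Fact (Nat.Prime 2) := ⟨Nat.prime_two⟩; W.HasGoodReductionAtPrime 2) →
      W.LFunction 2 = 0)
    (hS : ∀ ℓ : ℕ, (hℓ : ℓ.Prime) → ¬ (haveI := Fact.mk hℓ; W.HasGoodReductionAtPrime ℓ) →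
      ℓ = 3 ∨ ℓ = q ∨ (ℓ % 3 = 1 ∧ jacobiSym (ℓ : ℤ) q = -1 ∧ jacobiSym (-(r : ℤ)) ℓ = 1))
    (hr1 : W.analyticRank ≠ 0)
    (K : Type) [Field K] [NumberField K] (hK : IsImaginaryQuadratic K) (hdK : NumberField.discr K = -(r : ℤ))
    (hh : NumberField.classNumber K < q)
    (hGZ : gross_zagier (W.conductorNorm ℤ) W K) (hHP : exists_isHeegnerPoint W K) :
    IsImaginaryQuadratic K ∧ 4 < (NumberField.discr K).natAbs ∧
      SatisfiesHeegnerHypothesis (W.conductorNorm ℤ) K ∧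
      (W.quadraticTwist (NumberField.discr K : ℚ)).entireLFunction 1 ≠ 0 ∧
      NumberField.classNumber K < q ∧ ¬ q ∣ NumberField.classNumber K := by
  obtain ⟨hHN, hL, -⟩ := heegner_and_twist_L_one_ne_zero_of_prime_pair hKL hq4 hr4 hr3 h1 hs3 hsq hS₁ hS₂ hS₂' W hm hW h6
    h2 hS hr1 K hK hdK hGZ hHP
  have hr7 : 4 < r := by
    have h2le := hrp.out.two_le
    omega
  refine ⟨hK, by rw [hdK, Int.natAbs_neg, Int.natAbs_natCast]; exact hr7, hHN, hL, hh, fun hdvd => ?_⟩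
  exact absurd (Nat.le_of_dvd (NumberField.classNumber_pos (K := K)) hdvd) (not_le.mpr hh)

/-- ★ **The crux's `∃ K′` at `(W, q)` from a prime-pair certificate `(r; S₁, S₂)` with `h(−r) < q`** — the field `K′ = ℚ(√−r)`
PRODUCED in the tree (`SylvesterCorner.exists_field_of_odd`: `−r ≡ 1 (mod 4)` squarefree, `h(K′) = h(−r)` a kernel value of
`BinQF.classNumber`); the three named facts are taken for all imaginary quadratic fields (`hGZ`, `hHP`).
[cite: KrizLi2019, Thm. 1.20 (pp. 7–8)] [cite: GrossZagier1986, Thm. I.(6.3), V.§1–2] [cite: Cox2013, §2.A Thm. 2.13; §7.B Thm. 7.7(ii)] -/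
theorem exists_cruxConclusion_of_prime_pair (hKL : thm120_padicLogHeegner_unit_of_bernoulli)
    (hGZ : ∀ (N : ℕ) [NeZero N] (W : WeierstrassCurve ℚ) (K : Type) [Field K] [NumberField K], gross_zagier N W K)
    (hHP : ∀ (W : WeierstrassCurve ℚ) (K : Type) [Field K] [NumberField K], exists_isHeegnerPoint W K)
    {q r : ℕ} [hq : Fact q.Prime] [hrp : Fact r.Prime] (hq4 : q % 4 = 1) (hr4 : r % 4 = 3)
    (hr3 : r ≠ 3) (h1 : jacobiSym 3 q = -1)
    (hs3 : jacobiSym (-(r : ℤ)) 3 = 1) (hsq : jacobiSym (-(r : ℤ)) q = 1)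
    (hS₁ : ¬ ((3 : ℤ) ∣ ∑ j ∈ Finset.range (q * r),
      legendreSym q (j : ℤ) * legendreSym r (j : ℤ) * (j : ℤ)))
    (hS₂ : (3 : ℤ) ∣ ∑ j ∈ Finset.range (q * 3),
      legendreSym q (j : ℤ) * legendreSym 3 (j : ℤ) * (j : ℤ) ^ (0 + 1))
    (hS₂' : ¬ ((3 : ℤ) ^ 2 ∣ ∑ j ∈ Finset.range (q * 3),
      legendreSym q (j : ℤ) * legendreSym 3 (j : ℤ) * (j : ℤ) ^ (0 + 1)))
    {h : ℕ} (hclass : BinQF.classNumber (-(r : ℤ)) = h) (hhq : h < q)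
    (W : WeierstrassCurve ℚ) [W.IsElliptic] [W.IsGloballyMinimal] [NeZero (W.conductorNorm ℤ)]
    {m : ℤ} (hm : m ≠ 0) (hW : ∃ C : VariableChange ℚ, C • W = mordellCurve ((q : ℚ) * (m : ℚ) ^ 2))
    (h6 : ∀ ℓ : ℕ, ℓ.Prime → ¬ ((ℓ : ℤ) ^ 6 ∣ (q : ℤ) * m ^ 2))
    (h2 : (haveI : Fact (Nat.Prime 2) := ⟨Nat.prime_two⟩; W.HasGoodReductionAtPrime 2) →
      W.LFunction 2 = 0)
    (hS : ∀ ℓ : ℕ, (hℓ : ℓ.Prime) → ¬ (haveI := Fact.mk hℓ; W.HasGoodReductionAtPrime ℓ) →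
      ℓ = 3 ∨ ℓ = q ∨ (ℓ % 3 = 1 ∧ jacobiSym (ℓ : ℤ) q = -1 ∧ jacobiSym (-(r : ℤ)) ℓ = 1))
    (hr1 : W.analyticRank ≠ 0) :
    ∃ (K : Type) (_ : Field K) (_ : NumberField K),
      IsImaginaryQuadratic K ∧ 4 < (NumberField.discr K).natAbs ∧
      SatisfiesHeegnerHypothesis (W.conductorNorm ℤ) K ∧
      (W.quadraticTwist (NumberField.discr K : ℚ)).entireLFunction 1 ≠ 0 ∧ ¬ q ∣ NumberField.classNumber K := by
  have hr0 : (-(r : ℤ)) < 0 := by have := hrp.out.pos; omega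
  have hr4' : (-(r : ℤ)) % 4 = 1 := by omega
  have hsf : Squarefree (-(r : ℤ)).natAbs := by
    rw [Int.natAbs_neg, Int.natAbs_natCast]; exact hrp.out.squarefree
  obtain ⟨K, iF, iN, hK, hdK, hhK⟩ := SylvesterCorner.exists_field_of_odd (-(r : ℤ)) h hr0 hr4' hsf hclass
  obtain ⟨hK', hd4, hHN, hL, -, hndvd⟩ := cruxConclusion_of_prime_pair hKL hq4 hr4 hr3 h1 hs3 hsq hS₁ hS₂ hS₂' W hm hW h6 h2
    hS hr1 K hK hdK (by rw [hhK]; exact hhq) (hGZ _ W K) (hHP W K)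
  exact ⟨K, iF, iN, hK', hd4, hHN, hL, hndvd⟩

end Crux

end Summit.BirchSwinnertonDyer.BirchSwinnertonDyer.Theorems.KrizLiCornerQT27

end
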